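import Summits.HodgeConjecture.HodgeConjecture.Theorems.K2E3WittLeviCartanBlocks
import Summits.HodgeConjecture.HodgeConjecture.Theorems.K2E3WittCartanUnramified
import Summits.HodgeConjecture.HodgeConjecture.Theorems.K2E3LocalUnitaryWittStdFrame
import HarnessLib

/-!
# Levi Cartan decomposition of `U(σ, J₀)`, II-a: the first break — labels of `S` versus the blocks of `Q_{α₀+1}` and versus the shifted datum
# (crux H413, U12-g ∕ 13a road A, item (B) `hcartanLevi`)

Cell `hodgecm-mathlib`, Track B, line `K2_E3_EllipticInputs`, 13a road A; seat K2E3-p10 (g3).  THEOREMS ONLY; count-neutral helper.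

Combinatorics of the labelling `wittBlockOn e S` (★ `K2E3LocalUnitaryWittParabolicDefs`) of a standard indexing `e : WittIndex r m ≃ Fin N` (`m ≤ 1`) around the LEAST
break `α₀ ∉ S`, `c = α₀ + 1`, feeding the recursion of `K2E3WittLeviCartanRecursion`:

* `card_filter_breaks`, `card_breaks` — counting breaks through `α₀` and the SHIFTED datum `S′ = {α′ : Fin (r − c) | α′ + c ∈ S}`;
* `wittBlockNat_eq_zero_iff`, `wittBlockNat_eq_two_mul_iff`, `blockLabel_mono_of_wittBlockOn_le`, `blockLabel_eq_of_wittBlockOn_eq` — the `S`-labelling refines the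
  three blocks `[0,c) | [c,N−c) | [N−c,N)` of ★ `HermitianLattice.blockParabolic σ N c`; hence `mem_blockParabolic_of_mem_standardLeviGL`,
  `mem_standardParabolicGL_toDual_of_mem_standardLeviGL` (`M_S` is block diagonal for `Q_c`);
* `wittBlockNat_symm_midIndex` — on the middle block the `S`-label is `1 +` the `S′`-label in the standard indexing `stdWittEquivFin` of the middle block; hence
  `coe_midBlockU_mem_standardLeviGL` (the middle block of `g ∈ M_S` is in `M_{S′}`) and `coe_blockDiagLift_mem_standardLeviGL` (lifts of `M_{S′}`-data lie in
  `M_S`); `coe_blockDiagLift_mem_standardParabolicGL_toDual`.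

References: A. Borel (1991), §23; I. N. Bernstein, A. V. Zelevinsky (1977), §2.1; F. Bruhat, J. Tits (1972), (4.4.3); J. Rogawski (1990), §1.10.
-/

set_option autoImplicit false
set_option linter.dupNamespace false

noncomputable section

open scoped Valued WithZero Matrix MatrixGroups
open Matrix

namespace Summit.HodgeConjecture.HodgeConjecture.Cruxes.H413.K2E3WittLeviCartanLabels

open Literature.NumberTheory.Automorphic Literature.NumberTheory.Automorphic.HermitianLattice
open Literature.NumberTheory.Automorphic.CartanUnique
open K2E3LocalUnitaryWitt K2E3WittLeviCartanBlocks K2E3WittCartanUnramified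

/-! ## §1 The first break `α₀`: labels of `S` versus the three blocks of `Q_{α₀+1}` and versus the shifted datum -/

section Labels

variable {r : ℕ} {m : ℕ} {N : ℕ} (e : WittIndex r m ≃ Fin N)
  (hstd : ∀ x, (e x).val = Sum.elim (fun i : Fin r => i.val) (Sum.elim (fun u : Fin m => r + u.val) (fun j : Fin r => r + m + j.val)) x)
  (hm : m ≤ 1) {S : Finset (Fin r)} {α₀ : Fin r} (hα₀ : α₀ ∉ S) (hmin : ∀ α, α ∉ S → α₀ ≤ α)

include hα₀ hmin in
/-- **Counting breaks through the least break**: for any predicate `P`, `#{α ∉ S : P α} = [P α₀] + #{α′ ∉ S′ : P (α′ + c)}`, `c = α₀ + 1`, where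
`S′ = {α′ : Fin (r − c) | α′ + c ∈ S}` is the shifted datum (the breaks other than `α₀` are `≥ c`). [cite: Borel1991, §23] -/
theorem card_filter_breaks (P : Fin r → Prop) [DecidablePred P] :
    ((Finset.univ \ S).filter P).card = (if P α₀ then 1 else 0) +
      ((Finset.univ \ Finset.univ.filter fun α' : Fin (r - (α₀.val + 1)) =>
          (⟨α'.val + (α₀.val + 1), by have := α'.isLt; omega⟩ : Fin r) ∈ S).filter
        fun α' => P ⟨α'.val + (α₀.val + 1), by have := α'.isLt; omega⟩).card := by
  set T : Finset (Fin r) := ((Finset.univ \ S).erase α₀).filter P with hT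
  have hsplit : (Finset.univ \ S).filter P = if P α₀ then insert α₀ T else T := by
    have : Finset.univ \ S = insert α₀ ((Finset.univ \ S).erase α₀) := by
      rw [Finset.insert_erase]; simp [hα₀]
    rw [this, Finset.filter_insert]
  have hα₀T : α₀ ∉ T := by simp [hT]
  have hTcard : T.card = ((Finset.univ \ Finset.univ.filter fun α' : Fin (r - (α₀.val + 1)) =>
        (⟨α'.val + (α₀.val + 1), by have := α'.isLt; omega⟩ : Fin r) ∈ S).filter
      fun α' => P ⟨α'.val + (α₀.val + 1), by have := α'.isLt; omega⟩).card := by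
    symm
    refine Finset.card_nbij (fun α' : Fin (r - (α₀.val + 1)) => (⟨α'.val + (α₀.val + 1), by have := α'.isLt; omega⟩ : Fin r))
      (fun α' hα' => ?_) (fun α₁ _ α₂ _ h => ?_) (fun α hα => ?_)
    · simp only [Finset.mem_coe, Finset.mem_filter, Finset.mem_sdiff, Finset.mem_univ, true_and] at hα'
      simp only [hT, Finset.mem_coe, Finset.mem_filter, Finset.mem_erase, Finset.mem_sdiff, Finset.mem_univ, true_and]
      refine ⟨⟨fun h => ?_, hα'.1⟩, hα'.2⟩
      have h' : α'.val + (α₀.val + 1) = α₀.val := congrArg Fin.val h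
      omega
    · have h' : α₁.val + (α₀.val + 1) = α₂.val + (α₀.val + 1) := congrArg Fin.val h
      exact Fin.ext (by omega)
    · simp only [hT, Finset.coe_filter, Finset.mem_erase, Finset.mem_sdiff, Finset.mem_univ, true_and, Set.mem_setOf_eq] at hα
      obtain ⟨⟨hne, hαS⟩, hP⟩ := hα
      have hle : α₀ ≤ α := hmin α hαS
      have hlt : α₀.val < α.val := lt_of_le_of_ne (Fin.le_iff_val_le_val.1 hle) (fun h => hne (Fin.ext h).symm)
      have hαr := α.isLt
      have hval : (⟨(⟨α.val - (α₀.val + 1), by omega⟩ : Fin (r - (α₀.val + 1))).val + (α₀.val + 1), by omega⟩ : Fin r) = α :=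
        Fin.ext (by change α.val - (α₀.val + 1) + (α₀.val + 1) = α.val; omega)
      refine ⟨⟨α.val - (α₀.val + 1), by omega⟩, ?_, hval⟩
      simp only [Finset.coe_filter, Finset.mem_sdiff, Finset.mem_univ, true_and, Finset.mem_filter, Set.mem_setOf_eq, hval]
      exact ⟨hαS, hP⟩
  rw [hsplit]
  split_ifs with hP
  · rw [Finset.card_insert_of_notMem hα₀T, hTcard]; exact Nat.add_comm _ _
  · rw [hTcard, zero_add]

include hα₀ hmin in
/-- The number of breaks: `#(univ ∖ S) = 1 + #(univ ∖ S′)`. [cite: Borel1991, §23] -/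
theorem card_breaks :
    (Finset.univ \ S).card = 1 + (Finset.univ \ Finset.univ.filter fun α' : Fin (r - (α₀.val + 1)) =>
      (⟨α'.val + (α₀.val + 1), by have := α'.isLt; omega⟩ : Fin r) ∈ S).card := by
  have h := card_filter_breaks (m := m) (S := S) hα₀ hmin (fun _ => True)
  simp only [Finset.filter_true, if_true] at h
  exact h

include hstd hα₀ hmin in
/-- **Label `0` is the first block**: `wittBlockNat S x = 0 ↔ (e x) < α₀ + 1`. [cite: Borel1991, §23] -/
theorem wittBlockNat_eq_zero_iff (x : WittIndex r m) : wittBlockNat S x = 0 ↔ (e x).val < α₀.val + 1 := by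
  have hL : 1 ≤ (Finset.univ \ S).card := Finset.card_pos.2 ⟨α₀, by simp [hα₀]⟩
  rcases x with i | u | j
  · rw [hstd]; simp only [Sum.elim_inl]
    change ((Finset.univ \ S).filter fun α => α.val < i.val).card = 0 ↔ _
    rw [Finset.card_eq_zero, Finset.filter_eq_empty_iff]
    constructor
    · intro h
      have := h (x := α₀) (by simp [hα₀])
      omega
    · intro h α hα hlt
      have := Fin.le_iff_val_le_val.1 (hmin α (by simpa using hα))
      omega
  · rw [hstd]; simp only [Sum.elim_inr, Sum.elim_inl]
    change (Finset.univ \ S).card = 0 ↔ _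
    have := α₀.isLt
    omega
  · rw [hstd]; simp only [Sum.elim_inr]
    change (Finset.univ \ S).card + ((Finset.univ \ S).filter fun α => (Fin.rev α).val ≤ j.val).card = 0 ↔ _
    have := α₀.isLt
    omega

include hstd hm hα₀ hmin in
/-- **Label `2L` is the last block**: `wittBlockNat S x = 2 · #(univ ∖ S) ↔ N ≤ (e x) + (α₀ + 1)`. [cite: Borel1991, §23] -/
theorem wittBlockNat_eq_two_mul_iff (x : WittIndex r m) :
    wittBlockNat S x = 2 * (Finset.univ \ S).card ↔ N ≤ (e x).val + (α₀.val + 1) := by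
  have hN : N = r + (m + r) := by simpa using (Fintype.card_congr e).symm
  have hL : 1 ≤ (Finset.univ \ S).card := Finset.card_pos.2 ⟨α₀, by simp [hα₀]⟩
  have hα₀r := α₀.isLt
  rcases x with i | u | j
  · rw [hstd]; simp only [Sum.elim_inl]
    change ((Finset.univ \ S).filter fun α => α.val < i.val).card = _ ↔ _
    have h1 : ((Finset.univ \ S).filter fun α => α.val < i.val).card ≤ (Finset.univ \ S).card := Finset.card_filter_le _ _
    have := i.isLt
    omega
  · rw [hstd]; simp only [Sum.elim_inr, Sum.elim_inl]
    change (Finset.univ \ S).card = _ ↔ _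
    have := u.isLt
    omega
  · rw [hstd]; simp only [Sum.elim_inr]
    change (Finset.univ \ S).card + ((Finset.univ \ S).filter fun α => (Fin.rev α).val ≤ j.val).card = _ ↔ _
    have hiff : ((Finset.univ \ S).filter fun α => (Fin.rev α).val ≤ j.val).card = (Finset.univ \ S).card ↔ r ≤ j.val + (α₀.val + 1) := by
      rw [Finset.card_filter_eq_iff]
      constructor
      · intro h
        have := h α₀ (by simp [hα₀])
        rw [Fin.val_rev] at this
        omega
      · intro h α hα
        have := Fin.le_iff_val_le_val.1 (hmin α (by simpa using hα))
        rw [Fin.val_rev]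
        omega
    have h1 : ((Finset.univ \ S).filter fun α => (Fin.rev α).val ≤ j.val).card ≤ (Finset.univ \ S).card := Finset.card_filter_le _ _
    constructor
    · intro h; have := hiff.1 (by omega); omega
    · intro h; have := hiff.2 (by omega); omega

include hstd hm hα₀ hmin in
/-- **The labelling of `S` refines the three blocks of `Q_{α₀+1}`** (monotone comparison `wittBlockOn e S k ≤ wittBlockOn e S l → blockLabel k ≤ blockLabel l`).
[cite: BernsteinZelevinsky1977, §2.1] [cite: Borel1991, §23] -/
theorem blockLabel_mono_of_wittBlockOn_le {k l : Fin N} (hkl : wittBlockOn e S k ≤ wittBlockOn e S l) :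
    blockLabel N (α₀.val + 1) k ≤ blockLabel N (α₀.val + 1) l := by
  have h0 := wittBlockNat_eq_zero_iff e hstd hα₀ hmin
  have h2 := wittBlockNat_eq_two_mul_iff e hstd hm hα₀ hmin
  rw [Fin.le_iff_val_le_val, wittBlockOn_apply, wittBlockOn_apply, wittBlock_val, wittBlock_val] at hkl
  have hk := wittBlockNat_le S (e.symm k)
  have hl := wittBlockNat_le S (e.symm l)
  have h0k := h0 (e.symm k); have h0l := h0 (e.symm l); have h2k := h2 (e.symm k); have h2l := h2 (e.symm l)
  rw [e.apply_symm_apply] at h0k h0l h2k h2l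
  unfold blockLabel
  split_ifs <;> omega

include hstd hm hα₀ hmin in
/-- Equal `S`-labels have equal `Q_{α₀+1}`-blocks. [cite: BernsteinZelevinsky1977, §2.1] -/
theorem blockLabel_eq_of_wittBlockOn_eq {k l : Fin N} (hkl : wittBlockOn e S k = wittBlockOn e S l) :
    blockLabel N (α₀.val + 1) k = blockLabel N (α₀.val + 1) l :=
  le_antisymm (blockLabel_mono_of_wittBlockOn_le e hstd hm hα₀ hmin hkl.le) (blockLabel_mono_of_wittBlockOn_le e hstd hm hα₀ hmin hkl.ge)

variable {K : Type*} [Field K] {σ : K →+* K}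

include hstd hm hα₀ hmin in
/-- **`M_S ≤ Q_{α₀+1}`**: an element of `U(σ, J₀)` block diagonal for `wittBlockOn e S` is block upper triangular for the three blocks.
[cite: BernsteinZelevinsky1977, §2.1] [cite: BruhatTits1972, (4.4.3)] -/
theorem mem_blockParabolic_of_mem_standardLeviGL {g : unitaryGroupOfForm σ ((StdForm.antidiagonal N).over K)}
    (hg : (g : GL (Fin N) K) ∈ standardLeviGL K (wittBlockOn e S)) : g ∈ blockParabolic σ N (α₀.val + 1) := by
  rw [mem_blockParabolic_iff]
  rw [mem_standardLeviGL_iff] at hg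
  intro i j hij
  exact hg i j fun h => (blockLabel_eq_of_wittBlockOn_eq e hstd hm hα₀ hmin h).not_gt hij

include hstd hm hα₀ hmin in
/-- … and block LOWER triangular for them (block diagonal). [cite: BernsteinZelevinsky1977, §2.1] -/
theorem mem_standardParabolicGL_toDual_of_mem_standardLeviGL {g : GL (Fin N) K} (hg : g ∈ standardLeviGL K (wittBlockOn e S)) :
    g ∈ standardParabolicGL K (OrderDual.toDual ∘ blockLabel N (α₀.val + 1)) := by
  rw [mem_standardLeviGL_iff] at hg
  intro i j hij
  exact hg i j fun h => (OrderDual.toDual_lt_toDual.1 hij).ne (blockLabel_eq_of_wittBlockOn_eq e hstd hm hα₀ hmin h)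

omit hstd hm hα₀ hmin in
/-- A block-diagonal lift `diag(A, g', A†)` is block lower triangular for the three blocks. [cite: Rogawski1990, §1.10] -/
theorem coe_blockDiagLift_mem_standardParabolicGL_toDual (hσ : ∀ x, σ (σ x) = x) {c : ℕ} (hc : 2 * c ≤ N) (A : GL (Fin c) K)
    (g' : unitaryGroupOfForm σ ((StdForm.antidiagonal (N - 2 * c)).over K)) :
    ((blockDiagLift hσ hc A g' : unitaryGroupOfForm σ ((StdForm.antidiagonal N).over K)) : GL (Fin N) K) ∈
      standardParabolicGL K (OrderDual.toDual ∘ blockLabel N c) := by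
  intro i j hij
  rw [coe_blockDiagLift]
  exact blockDiagMatrix_apply_of_ne hc _ _ _ (OrderDual.toDual_lt_toDual.1 hij).ne

include hstd hα₀ hmin in
/-- **The shifted datum**: on the middle block of `Q_{α₀+1}`, the labelling of `S` is `1 +` the labelling of `S′ = {α′ : α′ + α₀ + 1 ∈ S}` in the standard
indexing `e′` of the middle block (Witt type `(r − α₀ − 1, m)`). [cite: Borel1991, §23] [cite: BernsteinZelevinsky1977, §2.1] -/
theorem wittBlockNat_symm_midIndex (hc : 2 * (α₀.val + 1) ≤ N) (hN' : (r - (α₀.val + 1)) + (m + (r - (α₀.val + 1))) = N - 2 * (α₀.val + 1))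
    (j : Fin (N - 2 * (α₀.val + 1))) :
    wittBlockNat S (e.symm (midIndex hc j)) = 1 +
      wittBlockNat (Finset.univ.filter fun α' : Fin (r - (α₀.val + 1)) => (⟨α'.val + (α₀.val + 1), by have := α'.isLt; omega⟩ : Fin r) ∈ S)
        ((stdWittEquivFin (r - (α₀.val + 1)) m hN').symm j) := by
  have hN : N = r + (m + r) := by simpa using (Fintype.card_congr e).symm
  have hα₀r := α₀.isLt
  have hstd' := stdWittEquivFin_hstd (r - (α₀.val + 1)) m hN'
  obtain ⟨y, rfl⟩ := (stdWittEquivFin (r - (α₀.val + 1)) m hN').surjective j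
  rw [Equiv.symm_apply_apply]
  have hmid : ∀ x : WittIndex r m, (e x).val = (α₀.val + 1) + (stdWittEquivFin (r - (α₀.val + 1)) m hN' y).val →
      e.symm (midIndex hc (stdWittEquivFin (r - (α₀.val + 1)) m hN' y)) = x := fun x hx => by
    rw [Equiv.symm_apply_eq]; exact Fin.ext (by rw [coe_midIndex, hx])
  rcases y with i' | u | j''
  · have hi' := i'.isLt
    rw [hmid (Sum.inl ⟨(α₀.val + 1) + i'.val, by omega⟩) (by rw [hstd, hstd']; rfl)]
    change ((Finset.univ \ S).filter fun α => α.val < (α₀.val + 1) + i'.val).card =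
      1 + ((Finset.univ \ _).filter fun α' : Fin (r - (α₀.val + 1)) => α'.val < i'.val).card
    rw [card_filter_breaks (m := m) hα₀ hmin, if_pos (by omega)]
    congr 2
    exact Finset.filter_congr fun (α' : Fin (r - (α₀.val + 1))) _ => by
      change α'.val + (α₀.val + 1) < (α₀.val + 1) + i'.val ↔ α'.val < i'.val
      omega
  · have hu := u.isLt
    rw [hmid (Sum.inr (Sum.inl u)) (by rw [hstd, hstd']; simp only [Sum.elim_inr, Sum.elim_inl]; omega)]
    exact card_breaks (m := m) hα₀ hmin
  · have hj'' := j''.isLt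
    rw [hmid (Sum.inr (Sum.inr ⟨j''.val, by omega⟩)) (by rw [hstd, hstd']; simp only [Sum.elim_inr]; omega)]
    change (Finset.univ \ S).card + ((Finset.univ \ S).filter fun α => (Fin.rev α).val ≤ j''.val).card =
      1 + ((Finset.univ \ _).card + ((Finset.univ \ _).filter fun α' : Fin (r - (α₀.val + 1)) => (Fin.rev α').val ≤ j''.val).card)
    rw [card_filter_breaks (m := m) hα₀ hmin, card_breaks (m := m) hα₀ hmin, if_neg (by rw [Fin.val_rev]; omega), zero_add, add_assoc]
    congr 2
    exact congrArg Finset.card (Finset.filter_congr fun (α' : Fin (r - (α₀.val + 1))) _ => by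
      have := α'.isLt
      change r - ((α'.val + (α₀.val + 1)) + 1) ≤ j''.val ↔ (r - (α₀.val + 1)) - (α'.val + 1) ≤ j''.val
      omega)

include hstd hα₀ hmin in
/-- **The middle block of `g ∈ M_S` is block diagonal for the shifted datum.** [cite: BernsteinZelevinsky1977, §2.1] -/
theorem coe_midBlockU_mem_standardLeviGL (hc : 2 * (α₀.val + 1) ≤ N) (hN' : (r - (α₀.val + 1)) + (m + (r - (α₀.val + 1))) = N - 2 * (α₀.val + 1))
    {g : unitaryGroupOfForm σ ((StdForm.antidiagonal N).over K)} (hg : (g : GL (Fin N) K) ∈ standardLeviGL K (wittBlockOn e S))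
    (hgP : g ∈ blockParabolic σ N (α₀.val + 1)) :
    ((midBlockU hc ⟨g, hgP⟩ : unitaryGroupOfForm σ ((StdForm.antidiagonal (N - 2 * (α₀.val + 1))).over K)) : GL (Fin (N - 2 * (α₀.val + 1))) K) ∈
      standardLeviGL K (wittBlockOn (stdWittEquivFin (r - (α₀.val + 1)) m hN')
        (Finset.univ.filter fun α' : Fin (r - (α₀.val + 1)) => (⟨α'.val + (α₀.val + 1), by have := α'.isLt; omega⟩ : Fin r) ∈ S)) := by
  rw [mem_standardLeviGL_iff] at hg ⊢
  intro j j' hjj'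
  rw [coe_midBlockU, midBlock_apply]
  refine hg _ _ fun h => hjj' (Fin.ext ?_)
  have h' := congrArg Fin.val h
  rw [wittBlockOn_apply, wittBlockOn_apply, wittBlock_val, wittBlock_val, wittBlockNat_symm_midIndex e hstd hα₀ hmin hc hN',
    wittBlockNat_symm_midIndex e hstd hα₀ hmin hc hN'] at h'
  rw [wittBlockOn_apply, wittBlockOn_apply, wittBlock_val, wittBlock_val]
  omega

include hstd hm hα₀ hmin in
/-- **A lift of shifted-Levi data lies in `M_S`**: `diag(A, g', A†) ∈ M_S` for ANY `A ∈ GL_{α₀+1}(K)` (the first block of `S` is a single block) and `g'` block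
diagonal for the shifted datum. [cite: BernsteinZelevinsky1977, §2.1] [cite: Rogawski1990, §1.10] -/
theorem coe_blockDiagLift_mem_standardLeviGL (hσ : ∀ x, σ (σ x) = x) (hc : 2 * (α₀.val + 1) ≤ N)
    (hN' : (r - (α₀.val + 1)) + (m + (r - (α₀.val + 1))) = N - 2 * (α₀.val + 1)) (A : GL (Fin (α₀.val + 1)) K)
    {g' : unitaryGroupOfForm σ ((StdForm.antidiagonal (N - 2 * (α₀.val + 1))).over K)}
    (hg' : (g' : GL (Fin (N - 2 * (α₀.val + 1))) K) ∈ standardLeviGL K (wittBlockOn (stdWittEquivFin (r - (α₀.val + 1)) m hN')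
        (Finset.univ.filter fun α' : Fin (r - (α₀.val + 1)) => (⟨α'.val + (α₀.val + 1), by have := α'.isLt; omega⟩ : Fin r) ∈ S))) :
    ((blockDiagLift hσ hc A g' : unitaryGroupOfForm σ ((StdForm.antidiagonal N).over K)) : GL (Fin N) K) ∈ standardLeviGL K (wittBlockOn e S) := by
  have h0 := wittBlockNat_eq_zero_iff e hstd hα₀ hmin
  have h2 := wittBlockNat_eq_two_mul_iff e hstd hm hα₀ hmin
  rw [mem_standardLeviGL_iff] at hg' ⊢
  intro p q hpq
  rw [coe_blockDiagLift]
  by_cases hb : blockLabel N (α₀.val + 1) p = blockLabel N (α₀.val + 1) q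
  · obtain ⟨x, rfl⟩ := (blockSum hc).surjective p
    obtain ⟨y, rfl⟩ := (blockSum hc).surjective q
    rcases x with (i | i) | i <;> rcases y with (j | j) | j <;>
      simp only [blockSum_inl_inl, blockSum_inl_inr, blockSum_inr, blockLabel_castLE hc, blockLabel_midIndex hc, blockLabel_hiIndex hc] at hb hpq ⊢
    all_goals first
      | exact absurd hb (by decide)
      | skip
    · -- first block: both labels are `0`
      exfalso; apply hpq
      have hi : wittBlockNat S (e.symm (Fin.castLE (le_of_two_mul_le hc) i)) = 0 := (h0 _).2 (by rw [e.apply_symm_apply]; exact i.isLt)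
      have hj : wittBlockNat S (e.symm (Fin.castLE (le_of_two_mul_le hc) j)) = 0 := (h0 _).2 (by rw [e.apply_symm_apply]; exact j.isLt)
      apply Fin.ext; rw [wittBlockOn_apply, wittBlockOn_apply, wittBlock_val, wittBlock_val, hi, hj]
    · -- middle block: the shifted labels differ
      rw [blockDiagMatrix_midIndex_midIndex]
      refine hg' _ _ fun h => hpq (Fin.ext ?_)
      have h' := congrArg Fin.val h
      rw [wittBlockOn_apply, wittBlockOn_apply, wittBlock_val, wittBlock_val] at h' ⊢
      rw [wittBlockNat_symm_midIndex e hstd hα₀ hmin hc hN', wittBlockNat_symm_midIndex e hstd hα₀ hmin hc hN', h']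
    · -- last block: both labels are `2L`
      exfalso; apply hpq
      have hi : wittBlockNat S (e.symm (hiIndex hc i)) = 2 * (Finset.univ \ S).card :=
        (h2 _).2 (by rw [e.apply_symm_apply, coe_hiIndex]; have := i.isLt; omega)
      have hj : wittBlockNat S (e.symm (hiIndex hc j)) = 2 * (Finset.univ \ S).card :=
        (h2 _).2 (by rw [e.apply_symm_apply, coe_hiIndex]; have := j.isLt; omega)
      apply Fin.ext; rw [wittBlockOn_apply, wittBlockOn_apply, wittBlock_val, wittBlock_val, hi, hj]
  · exact blockDiagMatrix_apply_of_ne hc _ _ _ hb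

end Labels

end Summit.HodgeConjecture.HodgeConjecture.Cruxes.H413.K2E3WittLeviCartanLabels

end
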